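import Summits.CriticalPhenomena.CardyFormulaZ2.Theses.CardyRotToConf
import Summits.CriticalPhenomena.CardyFormulaZ2.Theorems.CardyRotToConfR2SymmetryUpgrade.Negative.CruxConsequences
import Summits.CriticalPhenomena.CardyFormulaZ2.Theorems.CardyRotToConfR2SymmetryUpgradeNonTracing
import Summits.CriticalPhenomena.CardyFormulaZ2.Theorems.CardyRotToConfR2SymmetryUpgradeNoTracedLine
import Summits.CriticalPhenomena.CardyFormulaZ2.Theorems.CardyRotToConfR2SymmetryUpgradeSleNoEarlyTarget
import Summits.CriticalPhenomena.CardyFormulaZ2.Theorems.CardyRotToConfR2SymmetryUpgradeSleRangeNull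
import Summits.CriticalPhenomena.CardyFormulaZ2.Theorems.CardyRotToConfR2SymmetryUpgradeTipSeparation
import Summits.CriticalPhenomena.CardyFormulaZ2.Theorems.CardyRotToConfR2SymmetryUpgradeBranchComponents
import Summits.CriticalPhenomena.CardyFormulaZ2.Theorems.CardyRotToConfR2SymmetryUpgrade.Negative.SurgFatFamily
import Summits.CriticalPhenomena.CardyFormulaZ2.Theorems.CardyRotToConfR2SymmetryUpgrade.Negative.SurgFatMarkovKernel
import Literature.Topology.PlaneTopology.OsgoodArc
import Summits.CriticalPhenomena.CardyFormulaZ2.Theorems.CardyRotToConfR2SymmetryUpgradeFatDomain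
import Summits.CriticalPhenomena.CardyFormulaZ2.Theorems.CardyRotToConfR2SymmetryUpgradeTipSeparationGen
import Summits.CriticalPhenomena.CardyFormulaZ2.Theorems.CardyRotToConfR2SymmetryUpgradeSlitTrace
import Summits.CriticalPhenomena.CardyFormulaZ2.Theorems.CardyRotToConfR2SymmetryUpgradeFatSurgerySimilarity
import Summits.CriticalPhenomena.CardyFormulaZ2.Theorems.CardyRotToConfR2SymmetryUpgradeFatSurgeryLocal
import Summits.CriticalPhenomena.CardyFormulaZ2.Theorems.CardyRotToConfR2SymmetryUpgradeFatSurgeryTI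
import Summits.CriticalPhenomena.CardyFormulaZ2.Theorems.CardyRotToConfR2SymmetryUpgradeFatSurgeryWitness
import Summits.CriticalPhenomena.CardyFormulaZ2.Theorems.CardyRotToConfR2SymmetryUpgradeMarkovCore
import Summits.CriticalPhenomena.CardyFormulaZ2.Theorems.CardyRotToConfR2SymmetryUpgradeFatSurgeryChordal
import Literature.Probability.RandomPlanarGeometry.SLEExistenceNeEightHolds
import Literature.Probability.RandomPlanarGeometry.SLESixSplittingReduction
import Literature.Probability.RandomPlanarGeometry.SLEDomainMarkov
import Literature.Probability.RandomPlanarGeometry.SLESixMoebiusLocalityProofs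
import Literature.Probability.RandomPlanarGeometry.SLESixHullLocalityNbhdProved
import Literature.Probability.RandomPlanarGeometry.ConformalRestrictionCovariance
import Literature.Probability.RandomPlanarGeometry.CaratheodoryHalfPlaneProofs
import Literature.Probability.RandomPlanarGeometry.LocalMartingaleProofs
import Mathlib.MeasureTheory.Measure.Lebesgue.Complex
import HarnessLib

/-!
# Line `germ-label-transport` (lead c1, reshaped; lead c2, v9): ¬`CardyRotToConfR2SymmetryUpgrade`
# by the FAT-GERM one-shot surgery of the chordal SLE₆ family

Crux `stmt-CriticalPhenomena-0698` =
`Summit.CriticalPhenomena.CardyFormulaZ2.Theses.CardyRotToConf.CardyRotToConfR2SymmetryUpgrade`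
(`∀ P, IsLocalMarkovChordalFamily P → NonTracing P → ∀ D, IsSLELaw 6 D (P D)`).

NEGATIVE skeleton. The crux is refuted by TWO admissible non-tracing families that differ on ONE
Dobrushin domain (`Negative.CruxConsequences.not_crux_of_two_families`, any domain). Family one: any
family `Q` of chordal SLE₆ laws (exists: `exists_isSLELaw_of_ne_eight`; admissible: S1–S6 of the a1
lead, ALL LANDED — chordality, similarity covariance, typed domain Markov property
`ChordalFamily.isDomainMarkov_of_isSLELaw`, LSW locality `ChordalFamily.isLocal_of_isSLELaw_six_holds`,
target independence `isTargetIndependent_of_isSLELaw_six_of_moebius sle_six_moebius_locality_holds`,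
non-tracing `stub_nonTracing`). Family two (this reshaping, lead c1): the ONE-SHOT SURGERY of `Q` at
FAT GERMS. A Dobrushin domain `(U; a, b)` FIRES iff both branches of `∂U` at `a` have positive planar
Lebesgue measure in every ball about `a` and `U` contains, near `a`, exactly one open half-disc
`{⟨w - a, n⟩ > 0}`; the surgery curve is the straight chord from `a` in direction `n` up to its first
exit point `q ∈ ∂U`, followed (if `q ≠ b`) by an independent `Q`-curve of the crosscut domain
`(U_b; q, b)`; non-firing domains keep `Q`. Why fat germs (and not the disprover's round germs): every
conflict of the surgery's Markov kernel with `Q`'s own kernel is then `Q`-NULL by facts in the tree —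
the range of SLE₆ is Lebesgue-null (`IsSLELaw.ae_notMem_range` + Fubini: `stub_sleRangeNull`), so an
interior tip never fires (`∂V ⊆ range`), a boundary tip that fires has unvisited `V`-visible boundary
points on both branches, contradicting connectedness of the past by Newman's crosscut theorem
(`stub_tipSeparation`, `stub_branchComponents`), and mid-chord slit collisions pin a traced segment
(`stub_sleSixNoTracedSegment`, landed). No range-level circle/segment regularity of SLE₆ is needed.
The example firing domain is an Osgood-type Jordan domain (`stub_fatArc`, `stub_fatDomain`).

Stubs (lead c2, skeleton v9). CLOSED: `stub_fatArc` (= `exists_osgoodArc`, p127027), `stub_sleRangeNull`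
(p126617), `stub_sleNoEarlyTarget` (p126452), `stub_tipSeparation` (p126548), `stub_branchComponents`
(p126637), `stub_fatSurgeryChordal` (p127127). ALSO CLOSED (lead c2 waves 1–2 + lead): `stub_fatDomain` p128707, `stub_fatSurgerySimilarity` p128126,
`stub_fatSurgeryLocal` p128616, `stub_fatSurgeryTI` p128928, `stub_fatSurgeryWitness` p127959, `stub_tipSeparationGen` p128098,
`stub_slitTrace` p127953, `stub_fatSurgeryMarkovCore` (lead; helpers MarkovTip/Transfer/Prefix/KernelAE/Chord). NO SORRY LEFT. `stub_fatSurgery`, `stub_fatSurgeryMarkov` and the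
composition `not_CardyRotToConfR2SymmetryUpgrade_of : ¬ crux` are glue only.
-/

noncomputable section

open Set MeasureTheory Topology Filter Metric
open scoped unitInterval ENNReal NNReal

namespace Summit.CriticalPhenomena.CardyFormulaZ2.Cruxes.CardyRotToConfR2SymmetryUpgrade.GermLabelTransport

open Literature.Probability.RandomPlanarGeometry
open Literature.Probability.RandomPlanarGeometry.ChordalFamily
open Summit.CriticalPhenomena.CardyFormulaZ2.Theses.CardyRotToConf
open Summit.CriticalPhenomena.CardyFormulaZ2.Theorems.CardyRotToConfR2SymmetryUpgrade
open Summit.CriticalPhenomena.CardyFormulaZ2.Theorems.CardyRotToConfR2SymmetryUpgrade.Negative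

/-! ### Proved pieces: the SLE₆ family and its admissibility (all landed by the a1 lead) -/

/-- A family of chordal SLE₆ laws indexed by Dobrushin domains exists (Rohde–Schramm, proved in the
tree: `exists_isSLELaw_of_ne_eight`). [folklore] -/
theorem exists_sleSixLawFamily :
    ∃ Q : ChordalFamily, ∀ D : DobrushinDomain, IsSLELaw 6 D (Q D) :=
  ⟨fun D => (exists_isSLELaw_of_ne_eight (κ := 6) (by norm_num) (by norm_num) D).choose,
    fun D => (exists_isSLELaw_of_ne_eight (κ := 6) (by norm_num) (by norm_num) D).choose_spec⟩

/-- The chordal SLE₆ family is admissible: chordal, similarity covariant, domain Markov, local,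
target independent — every clause a theorem of the tree. [cite: Werner2007, §3.2 and Prop 3.4] -/
theorem isLocalMarkovChordalFamily_of_isSLELaw_six {Q : ChordalFamily}
    (hQ : ∀ D : DobrushinDomain, IsSLELaw 6 D (Q D)) : IsLocalMarkovChordalFamily Q := by
  haveI : Fact Literature.Probability.Process.isProjectiveLimit_preWienerMeasure :=
    ⟨isProjectiveLimit_preWienerMeasure_holds⟩
  exact ⟨fun D => ⟨(hQ D).isProbabilityMeasure,
      (hQ D).ae_endpoints JordanDomain.mapsTo_boundaryExtension_holds⟩,
    (ChordalFamily.isConformallyCovariant_of_isSLELaw hQ).isSimilarityCovariant,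
    ChordalFamily.isDomainMarkov_of_isSLELaw (by norm_num) hQ,
    ChordalFamily.isLocal_of_isSLELaw_six_holds hQ,
    ChordalFamily.isTargetIndependent_of_isSLELaw_six_of_moebius sle_six_moebius_locality_holds hQ⟩

/-! ### Stubs -/

/-- **S7a (stub).** An Osgood arc: a continuous injective curve in the closed unit square from `0`
to `1` whose trace has positive planar Lebesgue measure (Osgood 1903; here by threading a fat
Cantor dust with disjoint bridges). [cite: Osgood1903, Thm p. 107] -/
theorem stub_fatArc :
    ∃ γ : ℝ → ℂ, Continuous γ ∧ Set.InjOn γ (Set.Icc 0 1) ∧ γ 0 = 0 ∧ γ 1 = 1 ∧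
      (∀ t ∈ Set.Icc (0 : ℝ) 1, (γ t).re ∈ Set.Icc (0 : ℝ) 1 ∧ (γ t).im ∈ Set.Icc (0 : ℝ) 1) ∧
      0 < volume (γ '' Set.Icc (0 : ℝ) 1) :=
  Literature.Topology.PlaneTopology.exists_osgoodArc

/-- **S7b (stub).** The fat example domain: a Dobrushin domain `(D; 0, -2i)` whose two boundary
branches at `0` have positive area in every parameter neighbourhood of the mark, which contains the
lower half-disc near `0`, misses real points `±x` and some point of the open upper half-plane
arbitrarily close to `0`,
and whose vertical chord from `0` runs inside `D` down to `-2i`. (From an Osgood arc by a geometric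
series of similar copies on both sides of `0` and a rectangle below.) [folklore] -/
theorem stub_fatDomain :
    (∃ γ : ℝ → ℂ, Continuous γ ∧ Set.InjOn γ (Set.Icc 0 1) ∧ γ 0 = 0 ∧ γ 1 = 1 ∧
      (∀ t ∈ Set.Icc (0 : ℝ) 1, (γ t).re ∈ Set.Icc (0 : ℝ) 1 ∧ (γ t).im ∈ Set.Icc (0 : ℝ) 1) ∧
      0 < volume (γ '' Set.Icc (0 : ℝ) 1)) →
    ∃ D : DobrushinDomain, D.pt 0 = 0 ∧ D.pt 1 = -2 * Complex.I ∧
      (∀ ε : ℝ, 0 < ε → 0 < volume (D.boundary '' Set.Ioo (D.mark 0) (D.mark 0 + ε)) ∧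
        0 < volume (D.boundary '' Set.Ioo (D.mark 0 - ε) (D.mark 0))) ∧
      (∃ r : ℝ, 0 < r ∧ ∀ w : ℂ, ‖w‖ < r → w.im < 0 → w ∈ D.carrier) ∧
      (∀ r : ℝ, 0 < r → ∃ x : ℝ, 0 < x ∧ x < r ∧ (x : ℂ) ∉ D.carrier ∧ (-(x : ℂ)) ∉ D.carrier) ∧
      (∀ r : ℝ, 0 < r → ∃ w : ℂ, ‖w‖ < r ∧ 0 < w.im ∧ w ∉ D.carrier) ∧
      (∀ t : ℝ, 0 < t → t < 2 → -((t : ℂ) * Complex.I) ∈ D.carrier) :=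
  Summit.CriticalPhenomena.CardyFormulaZ2.Theorems.CardyRotToConfR2SymmetryUpgrade.stub_fatDomain

/-- **S7c (stub).** The range of chordal SLE₆ is Lebesgue-null almost surely (each fixed point
`w ≠ a, b` is a.s. avoided, `IsSLELaw.ae_notMem_range`; Fubini/Tonelli over `w`).
[cite: RohdeSchramm2005, Thm 6.4] -/
theorem stub_sleRangeNull :
    ∀ (D : DobrushinDomain) (μ : Measure (CurveClass ℂ)), IsSLELaw 6 D μ →
      ∀ᵐ γ ∂μ, volume γ.range = 0 :=
  Summit.CriticalPhenomena.CardyFormulaZ2.Theorems.CardyRotToConfR2SymmetryUpgrade.stub_sleRangeNull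

/-- **S7c′ (stub).** Chordal SLE₆ reaches its target only at the end: no representative of a
typical class visits `b = D.pt 1` and then leaves it (the trace is `Φ ∘ γ` with `b = Φ(∞)` and
`Φ` finite on the closed half-plane, `pt_notMem_image_boundaryExtension`). [cite: RohdeSchramm2005, Thm 7.1] -/
theorem stub_sleNoEarlyTarget :
    ∀ (D : DobrushinDomain) (μ : Measure (CurveClass ℂ)), IsSLELaw 6 D μ →
      ∀ᵐ γ ∂μ, ∀ c : Curve ℂ, CurveClass.mk c = γ →
        ∀ s t : unitInterval, s ≤ t → c s = D.pt 1 → c t = D.pt 1 :=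
  Summit.CriticalPhenomena.CardyFormulaZ2.Theorems.CardyRotToConfR2SymmetryUpgrade.stub_sleNoEarlyTarget

/-- **S7d (stub).** Tip separation (pure planar topology). `V ⊆ U` Dobrushin domains with the same
target, `K` a connected subset of `Ū` containing `U.pt 0 ≠ V.pt 0` and `V.pt 0`, disjoint from `V`
(the past of a curve and the target-side remaining domain). If BOTH boundary branches of `V` at
`V.pt 0` contain points of `∂U ∖ K` arbitrarily close to the mark (in parameter), contradiction:
a crosscut of `U` through `V` between two such points separates `V.pt 0` from `U.pt 0`
(Newman's crosscut theorem `Newman1939_crosscut_holds`, Carathéodory homeomorphism of `V̄`), while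
`K` is connected and misses the crosscut. [cite: Newman1939, Ch. V §11 Thm 11.8] -/
theorem stub_tipSeparation :
    ∀ (U V : DobrushinDomain) (K : Set ℂ), V.carrier ⊆ U.carrier → V.pt 1 = U.pt 1 →
      U.pt 0 ≠ V.pt 0 → IsConnected K → K ⊆ closure U.carrier → U.pt 0 ∈ K → V.pt 0 ∈ K →
      Disjoint K V.carrier →
      (∀ ε : ℝ, 0 < ε →
        (∃ s ∈ Set.Ioo (V.mark 0) (V.mark 0 + ε),
          V.boundary s ∈ frontier U.carrier ∧ V.boundary s ∉ K) ∧
        (∃ s ∈ Set.Ioo (V.mark 0 - ε) (V.mark 0),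
          V.boundary s ∈ frontier U.carrier ∧ V.boundary s ∉ K)) →
      False :=
  Summit.CriticalPhenomena.CardyFormulaZ2.Theorems.CardyRotToConfR2SymmetryUpgrade.stub_tipSeparation

/-- **S7e (stub).** Branch components (pure planar topology). For a Jordan domain, a boundary point
`a = ∂D(t₀)` and a ball `B(a, r)` not containing the whole curve, the two boundary branches at `a`
up to their first exits from the ball are connected components of `(∂D ∩ B(a, r)) ∖ {a}`, and they
are the only components accumulating at `a`. [folklore] -/
theorem stub_branchComponents :
    ∀ (D : JordanDomain) (t₀ r : ℝ), 0 < r → (∃ t : ℝ, D.boundary t ∉ ball (D.boundary t₀) r) →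
      ∃ δ₁ δ₂ : ℝ, 0 < δ₁ ∧ 0 < δ₂ ∧ δ₁ + δ₂ ≤ 1 ∧
        D.boundary '' Set.Ioo t₀ (t₀ + δ₁) ⊆ ball (D.boundary t₀) r ∧
        D.boundary '' Set.Ioo (t₀ - δ₂) t₀ ⊆ ball (D.boundary t₀) r ∧
        (∀ x ∈ D.boundary '' Set.Ioo t₀ (t₀ + δ₁),
          connectedComponentIn ((frontier D.carrier ∩ ball (D.boundary t₀) r) \ {D.boundary t₀}) x =
            D.boundary '' Set.Ioo t₀ (t₀ + δ₁)) ∧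
        (∀ x ∈ D.boundary '' Set.Ioo (t₀ - δ₂) t₀,
          connectedComponentIn ((frontier D.carrier ∩ ball (D.boundary t₀) r) \ {D.boundary t₀}) x =
            D.boundary '' Set.Ioo (t₀ - δ₂) t₀) ∧
        (∀ x ∈ (frontier D.carrier ∩ ball (D.boundary t₀) r) \ {D.boundary t₀},
          D.boundary t₀ ∈ closure
            (connectedComponentIn ((frontier D.carrier ∩ ball (D.boundary t₀) r) \ {D.boundary t₀}) x) →
          connectedComponentIn ((frontier D.carrier ∩ ball (D.boundary t₀) r) \ {D.boundary t₀}) x =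
              D.boundary '' Set.Ioo t₀ (t₀ + δ₁) ∨
            connectedComponentIn ((frontier D.carrier ∩ ball (D.boundary t₀) r) \ {D.boundary t₀}) x =
              D.boundary '' Set.Ioo (t₀ - δ₂) t₀) :=
  Summit.CriticalPhenomena.CardyFormulaZ2.Theorems.CardyRotToConfR2SymmetryUpgrade.stub_branchComponents

/-! ### Wave 3 (lead c2): topological inputs of the Markov property -/

/-- **S7d′ (stub).** Generalized tip separation (pure planar topology): as `stub_tipSeparation`, but
the base point `U.pt 0` of the big domain need not lie on `K` nor differ from the tip — it is only
required that the connected set `K` (the past) is not reduced to the tip `V.pt 0`. If BOTH boundary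
branches of `V` at `V.pt 0` carry points of `∂U ∖ K` with parameters arbitrarily close to the mark,
contradiction: a short cross-cut `L` of `V` (Schoenflies) between two such points close to the tip
is a cross-cut of `U`; by Newman's theorem the piece of `U ∖ L` adjacent to the tip has frontier
`L ∪` (short arc of `∂U`) inside a small ball, hence lies in that ball (bounded open set with small
frontier), and the connected set `K ∌ L`-points containing the tip lies in its closure — impossible
when `K` has a point far from the tip; the other Newman alternative puts `b` on the short arc.
[cite: Newman1939, Ch. V §11 Thm 11.8] -/
theorem stub_tipSeparationGen : ∀ (U V : DobrushinDomain) (K : Set ℂ), V.carrier ⊆ U.carrier → V.pt 1 = U.pt 1 → IsConnected K → K ⊆ closure U.carrier → V.pt 0 ∈ K → (∃ k ∈ K, k ≠ V.pt 0) → Disjoint K V.carrier → (∀ ε : ℝ, 0 < ε → (∃ s ∈ Set.Ioo (V.mark 0) (V.mark 0 + ε), V.boundary s ∈ frontier U.carrier ∧ V.boundary s ∉ K) ∧ (∃ s ∈ Set.Ioo (V.mark 0 - ε) (V.mark 0), V.boundary s ∈ frontier U.carrier ∧ V.boundary s ∉ K)) → False :=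
  Summit.CriticalPhenomena.CardyFormulaZ2.Theorems.CardyRotToConfR2SymmetryUpgrade.stub_tipSeparationGen

/-- **S7g (stub).** Slit configurations pin a traced segment (deterministic): if the typed remaining
domain of a stopped past `stopAt F γ` in `D` is a mid-chord slit configuration `D₁ ∖ [a₁, z]` of a
firing domain `D₁` with the tip `z` on the open chord, then some representative of `γ` traces a
non-degenerate straight segment (its final approach to `z` runs inside `D₁ ∩ range ⊆ [a₁, z]`).
[folklore] -/
theorem stub_slitTrace : ∀ (D D₁ : DobrushinDomain) (F : Set ℂ), IsClosed F → Summit.CriticalPhenomena.CardyFormulaZ2.Theorems.CardyRotToConfR2SymmetryUpgrade.Negative.Fires D₁.carrier (D₁.pt 0) → ∀ s : unitInterval, 0 < (s : ℝ) → (s : ℝ) < 1 → ∀ γ : CurveClass ℂ, γ.source = D.pt 0 → remainingDomain D (CurveClass.stopAt F γ) = D₁.carrier \ segment ℝ (D₁.pt 0) (Summit.CriticalPhenomena.CardyFormulaZ2.Theorems.CardyRotToConfR2SymmetryUpgrade.Negative.fireChord D₁ s) → (CurveClass.stopAt F γ).target = Summit.CriticalPhenomena.CardyFormulaZ2.Theorems.CardyRotToConfR2SymmetryUpgrade.Negative.fireChord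 D₁ s → ∃ c : Curve ℂ, CurveClass.mk c = γ ∧ ∃ s' t' : unitInterval, s' < t' ∧ Collinear ℝ (c '' Set.Icc s' t') ∧ ¬ (c '' Set.Icc s' t').Subsingleton :=
  Summit.CriticalPhenomena.CardyFormulaZ2.Theorems.CardyRotToConfR2SymmetryUpgrade.stub_slitTrace

/-! ### Wave 2: the fat surgery `Negative.fatSurgery S` is admissible (stubs over the landed definitions) -/

/-- **S7f.1 (stub).** The fat surgery of an admissible non-tracing family is chordal and
non-tracing. [folklore] -/
theorem stub_fatSurgeryChordal : ∀ S : ChordalFamily, IsLocalMarkovChordalFamily S → (∀ D : DobrushinDomain, ∀ᵐ γ ∂(S D), ∀ c : Curve ℂ, CurveClass.mk c = γ → ∀ s t : unitInterval, s < t → c '' Set.Icc s t ⊆ frontier D.carrier → (c '' Set.Icc s t).Subsingleton) → (Summit.CriticalPhenomena.CardyFormulaZ2.Theorems.CardyRotToConfR2SymmetryUpgrade.Negative.fatSurgery S).IsChordal ∧ (∀ D : DobrushinDomain, ∀ᵐ γ ∂(Summit.CriticalPhenomena.CardyFormulaZ2.Theorems.CardyRotToConfR2SymmetryUpgrade.Negative.fatSurgery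 S D), ∀ c : Curve ℂ, CurveClass.mk c = γ → ∀ s t : unitInterval, s < t → c '' Set.Icc s t ⊆ frontier D.carrier → (c '' Set.Icc s t).Subsingleton) :=
  Summit.CriticalPhenomena.CardyFormulaZ2.Theorems.CardyRotToConfR2SymmetryUpgrade.stub_fatSurgeryChordal

/-- **S7f.2 (stub).** The fat surgery of an admissible family is similarity covariant. [folklore] -/
theorem stub_fatSurgerySimilarity : ∀ S : ChordalFamily, IsLocalMarkovChordalFamily S → (Summit.CriticalPhenomena.CardyFormulaZ2.Theorems.CardyRotToConfR2SymmetryUpgrade.Negative.fatSurgery S).IsSimilarityCovariant :=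
  Summit.CriticalPhenomena.CardyFormulaZ2.Theorems.CardyRotToConfR2SymmetryUpgrade.stub_fatSurgerySimilarity

/-- **S7f.3 (stub).** The fat surgery of an admissible family is local (restriction form).
[folklore] -/
theorem stub_fatSurgeryLocal : ∀ S : ChordalFamily, IsLocalMarkovChordalFamily S → (Summit.CriticalPhenomena.CardyFormulaZ2.Theorems.CardyRotToConfR2SymmetryUpgrade.Negative.fatSurgery S).IsLocal :=
  Summit.CriticalPhenomena.CardyFormulaZ2.Theorems.CardyRotToConfR2SymmetryUpgrade.stub_fatSurgeryLocal

/-- **S7f.4 (stub).** The fat surgery of an admissible family is target independent. [folklore] -/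
theorem stub_fatSurgeryTI : ∀ S : ChordalFamily, IsLocalMarkovChordalFamily S → (Summit.CriticalPhenomena.CardyFormulaZ2.Theorems.CardyRotToConfR2SymmetryUpgrade.Negative.fatSurgery S).IsTargetIndependent :=
  Summit.CriticalPhenomena.CardyFormulaZ2.Theorems.CardyRotToConfR2SymmetryUpgrade.stub_fatSurgeryTI

/-- **S7f.5 (stub).** The fat example domain fires, its chord lands at `b`, and no segment-free
family charges the chord class. [folklore] -/
theorem stub_fatSurgeryWitness : (∃ D : DobrushinDomain, D.pt 0 = 0 ∧ D.pt 1 = -2 * Complex.I ∧ (∀ ε : ℝ, 0 < ε → 0 < MeasureTheory.volume (D.boundary '' Set.Ioo (D.mark 0) (D.mark 0 + ε)) ∧ 0 < MeasureTheory.volume (D.boundary '' Set.Ioo (D.mark 0 - ε) (D.mark 0))) ∧ (∃ r : ℝ, 0 < r ∧ ∀ w : ℂ, ‖w‖ < r → w.im < 0 → w ∈ D.carrier) ∧ (∀ r : ℝ, 0 < r → ∃ x : ℝ, 0 < x ∧ x < r ∧ (x : ℂ) ∉ D.carrier ∧ (-(x : ℂ)) ∉ D.carrier) ∧ (∀ r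 : ℝ, 0 < r → ∃ w : ℂ, ‖w‖ < r ∧ 0 < w.im ∧ w ∉ D.carrier) ∧ (∀ t : ℝ, 0 < t → t < 2 → -((t : ℂ) * Complex.I) ∈ D.carrier)) → ∃ D : DobrushinDomain, Summit.CriticalPhenomena.CardyFormulaZ2.Theorems.CardyRotToConfR2SymmetryUpgrade.Negative.Fires D.carrier (D.pt 0) ∧ Summit.CriticalPhenomena.CardyFormulaZ2.Theorems.CardyRotToConfR2SymmetryUpgrade.Negative.firePt D = D.pt 1 ∧ ∀ S : ChordalFamily, (∀ D : DobrushinDomain, ∀ᵐ γ ∂(S D), ∀ c : Curve ℂ, CurveClass.mk c = γ → ∀ s t : unitInterval, s < t → Collinear ℝ (c '' Set.Icc s t) → (c '' Set.Icc s t).Subsingleton) → S D ≠ MeasureTheory.Measure.dirac (CurveClass.mk (Summit.CriticalPhenomena.CardyFormulaZ2.Theorems.CardyRotToConfR2SymmetryUpgrade.Negative.fireChord D)) :=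
  Summit.CriticalPhenomena.CardyFormulaZ2.Theorems.CardyRotToConfR2SymmetryUpgrade.stub_fatSurgeryWitness

/-- **S7f.6′ (stub, lead).** Core of the Markov property: given generalized tip separation and the
slit-trace lemma, the fat surgery of an admissible, non-tracing, segment-free, range-null family
reaching its target only at the end is domain Markov (kernel `Negative.surgExt`). [folklore] -/
theorem stub_fatSurgeryMarkovCore : (∀ (U V : DobrushinDomain) (K : Set ℂ), V.carrier ⊆ U.carrier → V.pt 1 = U.pt 1 → IsConnected K → K ⊆ closure U.carrier → V.pt 0 ∈ K → (∃ k ∈ K, k ≠ V.pt 0) → Disjoint K V.carrier → (∀ ε : ℝ, 0 < ε → (∃ s ∈ Set.Ioo (V.mark 0) (V.mark 0 + ε), V.boundary s ∈ frontier U.carrier ∧ V.boundary s ∉ K) ∧ (∃ s ∈ Set.Ioo (V.mark 0 - ε) (V.mark 0), V.boundary s ∈ frontier U.carrier ∧ V.boundary s ∉ K)) → False) → (∀ (D D₁ : DobrushinDomain) (F : Set ℂ), IsClosed F → Summit.CriticalPhenomena.CardyFormulaZ2.Theorems.CardyRotToConfR2SymmetryUpgrade.Negative.Fires D₁.carrier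 (D₁.pt 0) → ∀ s : unitInterval, 0 < (s : ℝ) → (s : ℝ) < 1 → ∀ γ : CurveClass ℂ, γ.source = D.pt 0 → remainingDomain D (CurveClass.stopAt F γ) = D₁.carrier \ segment ℝ (D₁.pt 0) (Summit.CriticalPhenomena.CardyFormulaZ2.Theorems.CardyRotToConfR2SymmetryUpgrade.Negative.fireChord D₁ s) → (CurveClass.stopAt F γ).target = Summit.CriticalPhenomena.CardyFormulaZ2.Theorems.CardyRotToConfR2SymmetryUpgrade.Negative.fireChord D₁ s → ∃ c : Curve ℂ, CurveClass.mk c = γ ∧ ∃ s' t' : unitInterval, s' < t' ∧ Collinear ℝ (c '' Set.Icc s' t') ∧ ¬ (c '' Set.Icc s' t').Subsingleton) → ∀ S : ChordalFamily, IsLocalMarkovChordalFamily S → (∀ D : DobrushinDomain, ∀ᵐ γ ∂(S D), ∀ c : Curve ℂ, CurveClass.mk c = γ → ∀ s t : unitInterval, s < t → c '' Set.Icc s t ⊆ frontier D.carrier → (c '' Set.Icc s t).Subsingleton) → (∀ D : DobrushinDomain, ∀ᵐ γ ∂(S D), ∀ c : Curve ℂ, CurveClass.mk c = γ → ∀ s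 t : unitInterval, s < t → Collinear ℝ (c '' Set.Icc s t) → (c '' Set.Icc s t).Subsingleton) → (∀ D : DobrushinDomain, ∀ᵐ γ ∂(S D), MeasureTheory.volume γ.range = 0) → (∀ D : DobrushinDomain, ∀ᵐ γ ∂(S D), ∀ c : Curve ℂ, CurveClass.mk c = γ → ∀ s t : unitInterval, s ≤ t → c s = D.pt 1 → c t = D.pt 1) → (Summit.CriticalPhenomena.CardyFormulaZ2.Theorems.CardyRotToConfR2SymmetryUpgrade.Negative.fatSurgery S).IsDomainMarkov :=
  Summit.CriticalPhenomena.CardyFormulaZ2.Theorems.CardyRotToConfR2SymmetryUpgrade.stub_fatSurgeryMarkovCore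

/-- **S7f.6 (glue).** The fat surgery of an admissible, non-tracing, segment-free, range-null family
reaching its target only at the end is domain Markov. [folklore] -/
theorem stub_fatSurgeryMarkov : ∀ S : ChordalFamily, IsLocalMarkovChordalFamily S → (∀ D : DobrushinDomain, ∀ᵐ γ ∂(S D), ∀ c : Curve ℂ, CurveClass.mk c = γ → ∀ s t : unitInterval, s < t → c '' Set.Icc s t ⊆ frontier D.carrier → (c '' Set.Icc s t).Subsingleton) → (∀ D : DobrushinDomain, ∀ᵐ γ ∂(S D), ∀ c : Curve ℂ, CurveClass.mk c = γ → ∀ s t : unitInterval, s < t → Collinear ℝ (c '' Set.Icc s t) → (c '' Set.Icc s t).Subsingleton) → (∀ D : DobrushinDomain, ∀ᵐ γ ∂(S D), MeasureTheory.volume γ.range = 0) → (∀ D : DobrushinDomain, ∀ᵐ γ ∂(S D), ∀ c : Curve ℂ, CurveClass.mk c = γ → ∀ s t : unitInterval, s ≤ t → c s = D.pt 1 → c t = D.pt 1) → (Summit.CriticalPhenomena.CardyFormulaZ2.Theorems.CardyRotToConfR2SymmetryUpgrade.Negative.fatSurgery S).IsDomainMarkov :=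
  stub_fatSurgeryMarkovCore stub_tipSeparationGen stub_slitTrace

/-- **S7f (stub, lead).** The FAT-GERM ONE-SHOT SURGERY (SLE-free): from any admissible family `S`
whose curves are non-tracing, trace no straight segment, have Lebesgue-null range and reach their
target only at the end, and given the fat example domain and the two topological lemmas, the surgery
at fat germs is an admissible non-tracing family differing from `S` on some Dobrushin domain.
[folklore] -/
theorem stub_fatSurgery :
    ∀ S : ChordalFamily, IsLocalMarkovChordalFamily S →
      (∀ D : DobrushinDomain, ∀ᵐ γ ∂(S D), ∀ c : Curve ℂ, CurveClass.mk c = γ →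
        ∀ s t : unitInterval, s < t → c '' Set.Icc s t ⊆ frontier D.carrier →
          (c '' Set.Icc s t).Subsingleton) →
      (∀ D : DobrushinDomain, ∀ᵐ γ ∂(S D), ∀ c : Curve ℂ, CurveClass.mk c = γ →
        ∀ s t : unitInterval, s < t → Collinear ℝ (c '' Set.Icc s t) →
          (c '' Set.Icc s t).Subsingleton) →
      (∀ D : DobrushinDomain, ∀ᵐ γ ∂(S D), volume γ.range = 0) →
      (∀ D : DobrushinDomain, ∀ᵐ γ ∂(S D), ∀ c : Curve ℂ, CurveClass.mk c = γ →
        ∀ s t : unitInterval, s ≤ t → c s = D.pt 1 → c t = D.pt 1) →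
      -- the fat example domain (conclusion of `stub_fatDomain`)
      (∃ D : DobrushinDomain, D.pt 0 = 0 ∧ D.pt 1 = -2 * Complex.I ∧
        (∀ ε : ℝ, 0 < ε → 0 < volume (D.boundary '' Set.Ioo (D.mark 0) (D.mark 0 + ε)) ∧
          0 < volume (D.boundary '' Set.Ioo (D.mark 0 - ε) (D.mark 0))) ∧
        (∃ r : ℝ, 0 < r ∧ ∀ w : ℂ, ‖w‖ < r → w.im < 0 → w ∈ D.carrier) ∧
        (∀ r : ℝ, 0 < r → ∃ x : ℝ, 0 < x ∧ x < r ∧ (x : ℂ) ∉ D.carrier ∧ (-(x : ℂ)) ∉ D.carrier) ∧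
        (∀ r : ℝ, 0 < r → ∃ w : ℂ, ‖w‖ < r ∧ 0 < w.im ∧ w ∉ D.carrier) ∧
        (∀ t : ℝ, 0 < t → t < 2 → -((t : ℂ) * Complex.I) ∈ D.carrier)) →
      -- tip separation (statement of `stub_tipSeparation`)
      (∀ (U V : DobrushinDomain) (K : Set ℂ), V.carrier ⊆ U.carrier → V.pt 1 = U.pt 1 →
        U.pt 0 ≠ V.pt 0 → IsConnected K → K ⊆ closure U.carrier → U.pt 0 ∈ K → V.pt 0 ∈ K →
        Disjoint K V.carrier →
        (∀ ε : ℝ, 0 < ε →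
          (∃ s ∈ Set.Ioo (V.mark 0) (V.mark 0 + ε),
            V.boundary s ∈ frontier U.carrier ∧ V.boundary s ∉ K) ∧
          (∃ s ∈ Set.Ioo (V.mark 0 - ε) (V.mark 0),
            V.boundary s ∈ frontier U.carrier ∧ V.boundary s ∉ K)) →
        False) →
      -- branch components (statement of `stub_branchComponents`)
      (∀ (D : JordanDomain) (t₀ r : ℝ), 0 < r → (∃ t : ℝ, D.boundary t ∉ ball (D.boundary t₀) r) →
        ∃ δ₁ δ₂ : ℝ, 0 < δ₁ ∧ 0 < δ₂ ∧ δ₁ + δ₂ ≤ 1 ∧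
          D.boundary '' Set.Ioo t₀ (t₀ + δ₁) ⊆ ball (D.boundary t₀) r ∧
          D.boundary '' Set.Ioo (t₀ - δ₂) t₀ ⊆ ball (D.boundary t₀) r ∧
          (∀ x ∈ D.boundary '' Set.Ioo t₀ (t₀ + δ₁),
            connectedComponentIn ((frontier D.carrier ∩ ball (D.boundary t₀) r) \ {D.boundary t₀}) x =
              D.boundary '' Set.Ioo t₀ (t₀ + δ₁)) ∧
          (∀ x ∈ D.boundary '' Set.Ioo (t₀ - δ₂) t₀,
            connectedComponentIn ((frontier D.carrier ∩ ball (D.boundary t₀) r) \ {D.boundary t₀}) x =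
              D.boundary '' Set.Ioo (t₀ - δ₂) t₀) ∧
          (∀ x ∈ (frontier D.carrier ∩ ball (D.boundary t₀) r) \ {D.boundary t₀},
            D.boundary t₀ ∈ closure
              (connectedComponentIn ((frontier D.carrier ∩ ball (D.boundary t₀) r) \ {D.boundary t₀}) x) →
            connectedComponentIn ((frontier D.carrier ∩ ball (D.boundary t₀) r) \ {D.boundary t₀}) x =
                D.boundary '' Set.Ioo t₀ (t₀ + δ₁) ∨
              connectedComponentIn ((frontier D.carrier ∩ ball (D.boundary t₀) r) \ {D.boundary t₀}) x =
                D.boundary '' Set.Ioo (t₀ - δ₂) t₀)) →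
      ∃ J : ChordalFamily, IsLocalMarkovChordalFamily J ∧
        (∀ D : DobrushinDomain, ∀ᵐ γ ∂(J D), ∀ c : Curve ℂ, CurveClass.mk c = γ →
          ∀ s t : unitInterval, s < t → c '' Set.Icc s t ⊆ frontier D.carrier →
            (c '' Set.Icc s t).Subsingleton) ∧
        ∃ D : DobrushinDomain, J D ≠ S D := by
  intro S hS hnt hseg hnull hend hfat _ _
  refine ⟨Negative.fatSurgery S, ⟨(stub_fatSurgeryChordal S hS hnt).1, stub_fatSurgerySimilarity S hS,
    stub_fatSurgeryMarkov S hS hnt hseg hnull hend, stub_fatSurgeryLocal S hS, stub_fatSurgeryTI S hS⟩,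
    (stub_fatSurgeryChordal S hS hnt).2, ?_⟩
  obtain ⟨D, hfire, hq, hne⟩ := stub_fatSurgeryWitness hfat
  refine ⟨D, ?_⟩
  rw [Negative.fatSurgery_of_eq hfire hq]
  exact fun heq => hne S hseg heq.symm

/-! ### Composition -/

/-- **S7 reshaped: a second admissible non-tracing family differing from the SLE₆ family on some
Dobrushin domain** (glue of the seven stubs). [folklore] -/
theorem secondFamily_of_stubs {Q : ChordalFamily} (hQ : ∀ D : DobrushinDomain, IsSLELaw 6 D (Q D)) :
    ∃ J : ChordalFamily, IsLocalMarkovChordalFamily J ∧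
      (∀ D : DobrushinDomain, ∀ᵐ γ ∂(J D), ∀ c : Curve ℂ, CurveClass.mk c = γ →
        ∀ s t : unitInterval, s < t → c '' Set.Icc s t ⊆ frontier D.carrier →
          (c '' Set.Icc s t).Subsingleton) ∧
      ∃ D : DobrushinDomain, J D ≠ Q D :=
  stub_fatSurgery Q (isLocalMarkovChordalFamily_of_isSLELaw_six hQ) (stub_nonTracing Q hQ)
    (fun D => stub_sleSixNoTracedSegment D (Q D) (hQ D)) (fun D => stub_sleRangeNull D (Q D) (hQ D))
    (fun D => stub_sleNoEarlyTarget D (Q D) (hQ D)) (stub_fatDomain stub_fatArc) stub_tipSeparation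
    stub_branchComponents

/-- **The typed crux is false**: the SLE₆ family `Q` and its fat-germ one-shot surgery `J` are two
admissible non-tracing families that differ on some Dobrushin domain, contradicting the uniqueness
of the SLE₆ law under the crux (`not_crux_of_two_families`). [folklore] -/
theorem not_CardyRotToConfR2SymmetryUpgrade_of : ¬ CardyRotToConfR2SymmetryUpgrade := by
  obtain ⟨Q, hQ⟩ := exists_sleSixLawFamily
  have hadm := isLocalMarkovChordalFamily_of_isSLELaw_six hQ
  have hnt := stub_nonTracing Q hQ
  obtain ⟨J, hJ, hJnt, D, hne⟩ := secondFamily_of_stubs hQ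
  exact not_crux_of_two_families hJ hJnt hadm hnt (D := D) hne

end Summit.CriticalPhenomena.CardyFormulaZ2.Cruxes.CardyRotToConfR2SymmetryUpgrade.GermLabelTransport

end
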